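import Literature.Analysis.FluidPDE.KNSSTypeII
import Literature.Analysis.FluidPDE.KNSSTypeIIZoomIn
import Literature.Analysis.FluidPDE.KNSSBlowupLimit
import Literature.Analysis.FluidPDE.KNSSWindowLipschitz
import HarnessLib

/-!
# KNSS 2009, Theorem 6.1, proved from §4 (window regularity) and Theorem 5.3 (Liouville)

Analysis/FluidPDE proofs file for the named fact
`Literature.Analysis.FluidPDE.KNSS2009_regularity_bound_C_over_r` (`KNSSTypeII.lean`;
Koch–Nadirashvili–Seregin–Šverák, Acta Math. 203 (2009) = arXiv:0709.3599, **Theorem 6.1**: an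
axisymmetric solution on `ℝ³ × (0, T)`, bounded on every `ℝ³ × (0, T')`, `T' < T`, with
`|u(x, t)| ≤ C/√(x₁² + x₂²)`, is bounded on `ℝ³ × (0, T)`). Main result:

* `KNSS2009_regularity_bound_C_over_r_of_window_of_liouville :
    KNSS2009_regularity_boundedWeak_window → KNSS2009_liouville_bound_C_over_r →
    KNSS2009_regularity_bound_C_over_r`

— Theorem 6.1 **follows from** the two deep inputs of its printed proof, both accepted named
facts of the tree: the regularity theory of §4 on a finite window
(`KNSS2009_regularity_boundedWeak_window`, (4.10)–(4.11) with Lemma 3.1; file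
`KNSSRegularityWindow`) and the Liouville theorem 5.3 (`KNSS2009_liouville_bound_C_over_r`; file
`KNSSLiouville`). Everything else in the printed proof (arXiv p. 12, with the rescaling procedure
of p. 11) is proved here and in the support files `KNSSTypeIIZoomIn` (near-maximum selection,
the rescaled solutions (6.2) centred on the axis, their bound `2` up to the final time,
axisymmetry, scale invariance of (6.4), the offset `a_k = M_k x'_k` with `‖a_k‖ ≤ C`, uniform
Lipschitz bounds up to the final time), `KNSSWindowLipschitz` (the uniform regularity from §4:
`b` of Lemma 3.1 cannot oscillate under (6.4)), `KNSSBlowupLimit` (pointwise Arzelà–Ascoli, the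
limit is a bounded weak solution, a continuous field with a.e. vanishing slices vanishes up to
`s = 0`) and `ClassicalBoundedWeak` (classical solutions are bounded weak solutions).

## The proof (KNSS p. 12, as formalised)

Normalise `ν = 1` (`IsClassicalNSSolutionOn.viscosityRescale_set`). Suppose `u` is unbounded on
`(0, T) × ℝ³`. For each `n`, `exists_near_max` gives `t_n ∈ (0, T)`, `x_n` with
`M_n = ‖u(t_n, x_n)‖ > (n + 3)(1 + 1/T) + |B̄|` (`B̄` a bound on `(0, 3T/4) × ℝ³`, so
`t_n ≥ 3T/4`) and `‖u‖ ≤ 2M_n` on `(0, t_n] × ℝ³`. The rescaled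
`V_n(s, y) = M_n⁻¹ u(t_n + s/M_n², x_{n,3}e₃ + y/M_n)` are classical on `(A_n, B_n)`,
`A_n = −t_n M_n² ≤ −¾(n + 3)`, `B_n > 0`, bounded by `2` on `(A_n, 0]`, axisymmetric, with
`|y'|‖V_n‖ ≤ C` and `‖V_n(0, a_n)‖ = 1`, `a_n = M_n x_n'`, `‖a_n‖ ≤ C`. By
`KNSS2009_regularity_boundedWeak_window.lipschitz_of_cylRadius_bound` (at `M = 2`) and
`lipschitz_up_to_final_time`, the `V_n` are uniformly Lipschitz on `[A_n + 1, 0] × ℝ³`; clamping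
the time and extracting (`exists_strictMono_tendsto_of_lipschitzWith`, then a further
subsequence along which `a_n → a`), `V_n → v` pointwise on `(−∞, 0] × ℝ³`, `v` Lipschitz. The
limit is a bounded weak solution on `(−∞, 0)` (`isBoundedWeakNSSolutionOn_of_tendsto`),
axisymmetric with `|y'|‖v‖ ≤ C` (pointwise limits), so Theorem 5.3 gives `v(t, ·) = 0` a.e. for
a.e. `t < 0`, hence `v = 0` on `(−∞, 0] × ℝ³` (`forall_eq_zero_of_ae_slice_eq_zero`); but
`‖v(0, a)‖ = lim ‖V_n(0, a_n)‖ = 1` by the uniform Lipschitz bound — a contradiction.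

## References

* G. Koch, N. Nadirashvili, G. Seregin, V. Šverák, *Liouville theorems for the Navier–Stokes
  equations and applications*, Acta Math. 203 (2009) 83–105 = arXiv:0709.3599: §4 (p. 8), §5
  Theorem 5.3 (p. 10), §6 Lemma 6.1, Proposition 6.1, Theorem 6.1 with Remark 6.2 (p. 11) and
  its proof (p. 12). [KochNadirashviliSereginSverak2009]
-/

noncomputable section

open MeasureTheory Set Function Filter Topology TopologicalSpace Metric
open scoped NNReal

namespace Literature.Analysis.FluidPDE

open SereginSverak2009

/-! ### Rotations about the axis are continuous -/

/-- The rotation `R_θ` about the `x₃`-axis is continuous (it is linear on the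
finite-dimensional space `ℝ³`). [folklore] -/
theorem continuous_rotZ (θ : ℝ) : Continuous (rotZ θ) := by
  let L : EuclideanSpace ℝ (Fin 3) →ₗ[ℝ] EuclideanSpace ℝ (Fin 3) :=
    { toFun := rotZ θ
      map_add' := rotZ_add_vec θ
      map_smul' := fun c x => by simpa using rotZ_smul_vec θ c x }
  exact L.continuous_of_finiteDimensional

/-! ### Theorem 6.1 at unit viscosity -/

/-- **KNSS 2009, Theorem 6.1, at `ν = 1`, from §4 on a window and Theorem 5.3.** Let `(u, p)`
be a classical solution of the unforced Navier–Stokes system (`ν = 1`) on `(0, T) × ℝ³`,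
bounded on every `(0, T') × ℝ³`, `T' < T`, with axisymmetric slices and
`|x'| ‖u(t, x)‖ ≤ C`. Then `u` is bounded on `(0, T) × ℝ³`. Proof by contradiction through
the zoom-in of §6 (module docstring): near-maxima, rescaling (6.2) centred on the axis,
uniform Lipschitz bounds from `KNSS2009_regularity_boundedWeak_window`, pointwise
Arzelà–Ascoli, the limit bounded weak solution, Theorem 5.3, and `‖v(0, a)‖ = 1`. [cite: KochNadirashviliSereginSverak2009, Thm 6.1 and its proof (arXiv pp. 11–12)] -/
theorem KNSS2009_regularity_bound_C_over_r_one (hW : KNSS2009_regularity_boundedWeak_window)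
    (h53 : KNSS2009_liouville_bound_C_over_r) {T : ℝ}
    {u : ℝ → EuclideanSpace ℝ (Fin 3) → EuclideanSpace ℝ (Fin 3)}
    {p : ℝ → EuclideanSpace ℝ (Fin 3) → ℝ} (hT : 0 < T)
    (h : IsClassicalNSSolutionOn (Ioo 0 T) 1 0 u p)
    (hbdd : ∀ T' < T, ∃ M : ℝ, ∀ t ∈ Ioo 0 T', ∀ x, ‖u t x‖ ≤ M)
    (haxi : ∀ t ∈ Ioo 0 T, IsAxisymmetric (u t))
    (hC : ∃ C : ℝ, ∀ t ∈ Ioo 0 T, ∀ x, cylRadius x * ‖u t x‖ ≤ C) :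
    ∃ M : ℝ, ∀ t ∈ Ioo 0 T, ∀ x, ‖u t x‖ ≤ M := by
  obtain ⟨C₀, hC₀⟩ := hC
  by_contra hunb
  -- the uniform Lipschitz constant on unit windows (§4) at the bound `2`
  obtain ⟨K, hK0, hKprop⟩ := hW.lipschitz_of_cylRadius_bound 2
  -- a bound on `(0, 3T/4) × ℝ³`
  obtain ⟨Bbar, hBbar⟩ := hbdd (3 * T / 4) (by linarith)
  -- the near-maxima
  have hsel := fun n : ℕ => exists_near_max hbdd hunb (((n : ℝ) + 3) * (1 + 1 / T) + |Bbar|)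
  choose tn htn xn hR hmax using hsel
  set M : ℕ → ℝ := fun n => ‖u (tn n) (xn n)‖ with hMdef
  have hRpos : ∀ n : ℕ, (3 : ℝ) ≤ ((n : ℝ) + 3) * (1 + 1 / T) := fun n => by
    have h1 : (1 : ℝ) ≤ 1 + 1 / T := by simp [hT.le]
    nlinarith [n.cast_nonneg (α := ℝ)]
  have hM1 : ∀ n : ℕ, ((n : ℝ) + 3) * (1 + 1 / T) ≤ M n := fun n => by
    have := hR n; linarith [abs_nonneg Bbar]
  have hMone : ∀ n, 1 ≤ M n := fun n => by linarith [hRpos n, hM1 n]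
  have hMpos : ∀ n, 0 < M n := fun n => by linarith [hMone n]
  have htn34 : ∀ n, 3 * T / 4 ≤ tn n := fun n => by
    by_contra hlt
    push Not at hlt
    have h1 : M n ≤ Bbar := hBbar (tn n) ⟨(htn n).1, hlt⟩ (xn n)
    have h2 : |Bbar| < M n := by have := hR n; linarith [hRpos n]
    linarith [le_abs_self Bbar]
  -- the scaling factors and the time intervals of the rescaled solutions
  set c : ℕ → ℝ := fun n => (M n)⁻¹ with hcdef
  have hcpos : ∀ n, 0 < c n := fun n => inv_pos.2 (hMpos n)
  have hceq : ∀ n, c n = ‖u (tn n) (xn n)‖⁻¹ := fun n => rfl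
  set A : ℕ → ℝ := fun n => -(tn n / c n ^ 2) with hAdef
  set B : ℕ → ℝ := fun n => (T - tn n) / c n ^ 2 with hBdef
  have hAle : ∀ n : ℕ, A n ≤ -(((n : ℝ) + 3) * (3 / 4)) := fun n => by
    have hA' : A n = -(tn n * M n ^ 2) := by
      simp only [hAdef, hcdef, inv_pow, div_inv_eq_mul]
    rw [hA', neg_le_neg_iff]
    have h1 : ((n : ℝ) + 3) * (1 + 1 / T) * 1 ≤ M n * M n :=
      mul_le_mul (hM1 n) (hMone n) zero_le_one (hMpos n).le
    have h2 : T * (1 + 1 / T) = T + 1 := by field_simp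
    have h3 : 3 * T / 4 * (((n : ℝ) + 3) * (1 + 1 / T)) ≤ tn n * M n ^ 2 := by
      rw [sq]
      exact mul_le_mul (htn34 n) (by simpa using h1) (by nlinarith [hRpos n]) (htn n).1.le
    have h4 : 3 * T / 4 * (((n : ℝ) + 3) * (1 + 1 / T)) = ((n : ℝ) + 3) * (3 / 4) * (T + 1) := by
      rw [← h2]; ring
    nlinarith [n.cast_nonneg (α := ℝ)]
  have hA2 : ∀ n, A n ≤ -2 := fun n => by nlinarith [hAle n, n.cast_nonneg (α := ℝ)]
  have hBpos : ∀ n, 0 < B n := fun n => div_pos (by linarith [(htn n).2]) (pow_pos (hcpos n) 2)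
  have hAtend : Tendsto A atTop atBot := by
    refine tendsto_atBot_mono hAle (tendsto_neg_atTop_atBot.comp ?_)
    exact (tendsto_natCast_atTop_atTop.atTop_add tendsto_const_nhds).atTop_mul_const (by norm_num)
  -- the rescaled solutions (6.2), centred on the axis
  set V : ℕ → ℝ → EuclideanSpace ℝ (Fin 3) → EuclideanSpace ℝ (Fin 3) :=
    fun n => c n • stPull (c n ^ 2) (c n) (tn n) (xn n 2 • eZ) u with hVdef
  set P : ℕ → ℝ → EuclideanSpace ℝ (Fin 3) → ℝ :=
    fun n => c n ^ 2 • stPull (c n ^ 2) (c n) (tn n) (xn n 2 • eZ) p with hPdef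
  have hVcl : ∀ n, IsClassicalNSSolutionOn (Ioo (A n) (B n)) 1 0 (V n) (P n) := fun n =>
    zoom_isClassicalNSSolutionOn h (hcpos n) (tn n) (xn n)
  have hVbd : ∀ n, ∀ s ∈ Ioc (A n) 0, ∀ y, ‖V n s y‖ ≤ 2 := fun n =>
    zoom_norm_le_two (hmax n) (hMpos n) (hceq n)
  have hVmem : ∀ n, ∀ s ∈ Ioo (A n) (B n), tn n + c n ^ 2 * s ∈ Ioo 0 T := fun n s hs =>
    zoom_time_mem (hcpos n).ne' hs
  have hVaxi : ∀ n, ∀ s ∈ Ioo (A n) (B n), IsAxisymmetric (V n s) := fun n s hs =>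
    zoom_isAxisymmetric haxi (hVmem n s hs)
  have hVdec : ∀ n, ∀ s ∈ Ioo (A n) (B n), ∀ y, cylRadius y * ‖V n s y‖ ≤ C₀ := fun n s hs y =>
    zoom_cylRadius_mul_norm_le hC₀ (hcpos n) (hVmem n s hs) y
  set a : ℕ → EuclideanSpace ℝ (Fin 3) := fun n => (c n)⁻¹ • horiz (xn n) with hadef
  have hVone : ∀ n, ‖V n 0 (a n)‖ = 1 := fun n => norm_zoom_apply_zero_offset (hMpos n) (hceq n)
  have hale : ∀ n, ‖a n‖ ≤ C₀ := fun n => norm_zoom_offset_le hC₀ (htn n) (hMpos n) (hceq n)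
  have hVcont : ∀ n, ContinuousOn (uncurry (V n)) (Ioo (A n) (B n) ×ˢ univ) := fun n =>
    (hVcl n).smooth_velocity.continuousOn
  -- uniform Lipschitz bound on `[A n + 1, 0] × ℝ³`, and the clamped maps
  have hLip : ∀ n, ∀ s ∈ Icc (A n + 1) 0, ∀ t ∈ Icc (A n + 1) 0, ∀ x y,
      ‖V n t x - V n s y‖ ≤ max K 8 * (|t - s| + ‖x - y‖) := fun n =>
    lipschitz_up_to_final_time (hKprop C₀) (hA2 n) (hBpos n) (hVcl n) (hVbd n) (hVdec n)
  set W : ℕ → ℝ × EuclideanSpace ℝ (Fin 3) → EuclideanSpace ℝ (Fin 3) :=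
    fun n z => V n (max (A n + 1) (min z.1 0)) z.2 with hWdef
  have hK8 : 0 ≤ max K 8 := hK0.trans (le_max_left _ _)
  have hWlip : ∀ n, LipschitzWith (Real.toNNReal (2 * max K 8)) (W n) := fun n =>
    lipschitzWith_clamp hK8 (by linarith [hA2 n]) (hLip n)
  have hclamp : ∀ n (r : ℝ), max (A n + 1) (min r 0) ∈ Ioc (A n) 0 := fun n r =>
    ⟨by linarith [le_max_left (A n + 1) (min r 0)], max_le (by linarith [hA2 n]) (min_le_right _ _)⟩
  have hWball : ∀ n z, W n z ∈ closedBall (0 : EuclideanSpace ℝ (Fin 3)) 2 := fun n z =>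
    mem_closedBall_zero_iff.2 (hVbd n _ (hclamp n z.1) z.2)
  -- extraction: pointwise convergence of the clamped maps, then of the offsets
  obtain ⟨φ, Winf, hφ, hWinflip, -, hWconv⟩ :=
    exists_strictMono_tendsto_of_lipschitzWith W hWlip hWball
  obtain ⟨ainf, -, ψ, hψ, haconv⟩ := tendsto_subseq_of_bounded (x := a ∘ φ)
    (isBounded_closedBall (x := (0 : EuclideanSpace ℝ (Fin 3))) (r := C₀))
    (fun n => mem_closedBall_zero_iff.2 (hale (φ n)))
  set θ : ℕ → ℕ := φ ∘ ψ with hθdef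
  have hθ : StrictMono θ := hφ.comp hψ
  have hWconvθ : ∀ z, Tendsto (fun m => W (θ m) z) atTop (𝓝 (Winf z)) := fun z =>
    (hWconv z).comp hψ.tendsto_atTop
  have haconvθ : Tendsto (fun m => a (θ m)) atTop (𝓝 ainf) := haconv
  have hAθ : Tendsto (fun m => A (θ m)) atTop atBot := hAtend.comp hθ.tendsto_atTop
  have hevA : ∀ t : ℝ, ∀ᶠ m in atTop, A (θ m) + 1 ≤ t := fun t =>
    (hAθ.eventually (eventually_le_atBot (t - 1))).mono fun m hm => by linarith
  -- the limit field
  set v : ℝ → EuclideanSpace ℝ (Fin 3) → EuclideanSpace ℝ (Fin 3) := fun t x => Winf (t, x)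
    with hvdef
  have hvcont : Continuous (uncurry v) := hWinflip.continuous
  have hVlim : ∀ t ≤ 0, ∀ x, Tendsto (fun m => V (θ m) t x) atTop (𝓝 (v t x)) := by
    intro t ht x
    refine (hWconvθ (t, x)).congr' ((hevA t).mono fun m hm => ?_)
    show V (θ m) (max (A (θ m) + 1) (min t 0)) x = V (θ m) t x
    rw [min_eq_left ht, max_eq_right hm]
  have hevmem : ∀ t < 0, ∀ᶠ m in atTop, t ∈ Ioo (A (θ m)) (B (θ m)) := fun t ht =>
    (hevA t).mono fun m hm => ⟨by linarith, ht.trans (hBpos _)⟩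
  -- the limit is a bounded weak solution on `(-∞, 0)`
  have hweak : IsBoundedWeakNSSolutionOn (Iio 0) isOpen_Iio 1 v := by
    refine isBoundedWeakNSSolutionOn_of_tendsto (A := fun m => A (θ m)) (V := fun m => V (θ m))
      (M := 2) hAθ (fun m => ?_) (fun m => ?_) (fun m s hs y => hVbd (θ m) s ⟨hs.1, hs.2.le⟩ y)
      hvcont (fun t ht x => hVlim t ht.le x)
    · have hcl : IsClassicalNSSolutionOn (Ioo (A (θ m)) 0) 1 0 (V (θ m)) (P (θ m)) :=
        (hVcl (θ m)).mono (Ioo_subset_Ioo_right (hBpos _).le) (uniqueDiffOn_Ioo _ _)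
      exact hcl.isBoundedWeakNSSolutionOn ⟨2, fun s hs y => hVbd (θ m) s ⟨hs.1, hs.2.le⟩ y⟩
    · exact (hVcont (θ m)).mono (prod_mono (Ioo_subset_Ioo_right (hBpos _).le) Subset.rfl)
  -- axisymmetry and the decay bound pass to the limit
  have hvaxi : ∀ t < 0, IsAxisymmetric (v t) := by
    intro t ht θ' y
    have h1 : Tendsto (fun m => V (θ m) t (rotZ θ' y)) atTop (𝓝 (v t (rotZ θ' y))) :=
      hVlim t ht.le _
    have h2 : Tendsto (fun m => rotZ θ' (V (θ m) t y)) atTop (𝓝 (rotZ θ' (v t y))) :=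
      ((continuous_rotZ θ').tendsto _).comp (hVlim t ht.le y)
    have heq : (fun m => rotZ θ' (V (θ m) t y)) =ᶠ[atTop] fun m => V (θ m) t (rotZ θ' y) :=
      (hevmem t ht).mono fun m hm => (hVaxi (θ m) t hm θ' y).symm
    exact tendsto_nhds_unique h1 (h2.congr' heq)
  have hvdec : ∀ t < 0, ∀ y, cylRadius y * ‖v t y‖ ≤ C₀ := by
    intro t ht y
    exact le_of_tendsto ((hVlim t ht.le y).norm.const_mul (cylRadius y))
      ((hevmem t ht).mono fun m hm => hVdec (θ m) t hm y)
  -- Theorem 5.3: the limit vanishes, up to the final time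
  have hzero := h53.of_pointwise hweak hvaxi ⟨C₀, hvdec⟩
  have hv0 : v 0 ainf = 0 := forall_eq_zero_of_ae_slice_eq_zero hvcont hzero 0 le_rfl ainf
  -- but `‖v(0, a)‖ = lim ‖V_n(0, a_n)‖ = 1`
  have hWa : Tendsto (fun m => W (θ m) (0, a (θ m))) atTop (𝓝 (Winf (0, ainf))) := by
    rw [tendsto_iff_dist_tendsto_zero]
    have h1 : ∀ m, dist (W (θ m) (0, a (θ m))) (Winf (0, ainf)) ≤
        2 * max K 8 * dist (a (θ m)) ainf + dist (W (θ m) (0, ainf)) (Winf (0, ainf)) := by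
      intro m
      have hd : dist (W (θ m) (0, a (θ m))) (W (θ m) (0, ainf)) ≤
          2 * max K 8 * dist (a (θ m)) ainf := by
        have := (hWlip (θ m)).dist_le_mul ((0 : ℝ), a (θ m)) ((0 : ℝ), ainf)
        rw [Real.coe_toNNReal _ (by positivity), Prod.dist_eq, dist_self,
          max_eq_right dist_nonneg] at this
        exact this
      linarith [dist_triangle (W (θ m) (0, a (θ m))) (W (θ m) (0, ainf)) (Winf (0, ainf))]
    have h2 : Tendsto (fun m => 2 * max K 8 * dist (a (θ m)) ainf +
        dist (W (θ m) (0, ainf)) (Winf (0, ainf))) atTop (𝓝 0) := by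
      have t1 := (tendsto_iff_dist_tendsto_zero.1 haconvθ).const_mul (2 * max K 8)
      have t2 := tendsto_iff_dist_tendsto_zero.1 (hWconvθ (0, ainf))
      simpa using t1.add t2
    exact squeeze_zero (fun m => dist_nonneg) h1 h2
  have hnorm1 : ‖Winf (0, ainf)‖ = 1 := by
    have h1 : Tendsto (fun m => ‖W (θ m) (0, a (θ m))‖) atTop (𝓝 ‖Winf (0, ainf)‖) := hWa.norm
    have h2 : ∀ m, ‖W (θ m) (0, a (θ m))‖ = 1 := fun m => by
      show ‖V (θ m) (max (A (θ m) + 1) (min 0 0)) (a (θ m))‖ = 1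
      rw [min_self, max_eq_right (by linarith [hA2 (θ m)])]
      exact hVone (θ m)
    refine tendsto_nhds_unique h1 ?_
    simp_rw [h2]
    exact tendsto_const_nhds
  have hv0' : Winf (0, ainf) = 0 := hv0
  rw [hv0', norm_zero] at hnorm1
  exact zero_ne_one hnorm1

/-! ### Theorem 6.1 for every viscosity -/

/-- **KNSS 2009, Theorem 6.1, from §4 on a window and Theorem 5.3** (Acta Math. 203 (2009) =
arXiv:0709.3599, Thm. 6.1 p. 11 with its proof p. 12): the named fact
`KNSS2009_regularity_bound_C_over_r` follows from the accepted named facts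
`KNSS2009_regularity_boundedWeak_window` (§4, (4.10)–(4.11) with Lemma 3.1) and
`KNSS2009_liouville_bound_C_over_r` (Thm. 5.3). General viscosity `ν > 0` is reduced to `ν = 1`
by the rescaling `v(s, x) = ν⁻¹ u(s/ν, x)` (`IsClassicalNSSolutionOn.viscosityRescale_set`),
which preserves axisymmetry and multiplies both bounds by `ν⁻¹`. [cite: KochNadirashviliSereginSverak2009, Thm 6.1 (arXiv p. 11) with its proof (p. 12), §4 (4.10)–(4.11) and Thm 5.3] -/
theorem KNSS2009_regularity_bound_C_over_r_of_window_of_liouville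
    (hW : KNSS2009_regularity_boundedWeak_window) (h53 : KNSS2009_liouville_bound_C_over_r) :
    KNSS2009_regularity_bound_C_over_r := by
  intro ν T u p hν hT h hbdd haxi hC
  have hν' : 0 < ν⁻¹ := inv_pos.2 hν
  -- rescale the viscosity to `1`
  set v : ℝ → EuclideanSpace ℝ (Fin 3) → EuclideanSpace ℝ (Fin 3) := timeRescale ν⁻¹ ν⁻¹ u
    with hvdef
  have hmaps : MapsTo (fun s => ν⁻¹ * s) (Ioo 0 (ν * T)) (Ioo 0 T) := fun s hs =>
    (inv_mul_mem_Ioo_iff hν).2 hs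
  have h1 : IsClassicalNSSolutionOn (Ioo 0 (ν * T)) 1 0 v (timeRescale ν⁻¹ (ν⁻¹ ^ 2) p) := by
    have := h.viscosityRescale_set hν.ne' hmaps (uniqueDiffOn_Ioo 0 (ν * T))
    simpa only [timeRescale_zero_force] using this
  have hbdd1 : ∀ T' < ν * T, ∃ M : ℝ, ∀ s ∈ Ioo 0 T', ∀ x, ‖v s x‖ ≤ M := by
    intro T' hT'
    obtain ⟨M, hM⟩ := hbdd (ν⁻¹ * T') (by rwa [inv_mul_lt_iff₀ hν])
    refine ⟨ν⁻¹ * M, fun s hs x => ?_⟩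
    rw [hvdef, timeRescale_apply, norm_smul, Real.norm_eq_abs, abs_of_pos hν']
    exact mul_le_mul_of_nonneg_left
      (hM _ ⟨mul_pos hν' hs.1, mul_lt_mul_of_pos_left hs.2 hν'⟩ x) hν'.le
  have haxi1 : ∀ s ∈ Ioo 0 (ν * T), IsAxisymmetric (v s) := by
    intro s hs θ' x
    rw [hvdef, timeRescale_apply, timeRescale_apply, haxi _ (hmaps hs) θ' x, rotZ_smul_vec]
  have hC1 : ∃ C : ℝ, ∀ s ∈ Ioo 0 (ν * T), ∀ x, cylRadius x * ‖v s x‖ ≤ C := by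
    obtain ⟨C, hC⟩ := hC
    refine ⟨ν⁻¹ * C, fun s hs x => ?_⟩
    rw [hvdef, timeRescale_apply, norm_smul, Real.norm_eq_abs, abs_of_pos hν', mul_left_comm]
    exact mul_le_mul_of_nonneg_left (hC _ (hmaps hs) x) hν'.le
  obtain ⟨M₁, hM₁⟩ := KNSS2009_regularity_bound_C_over_r_one hW h53 (mul_pos hν hT) h1 hbdd1
    haxi1 hC1
  refine ⟨ν * M₁, fun t ht x => ?_⟩
  have hs : ν * t ∈ Ioo 0 (ν * T) := ⟨mul_pos hν ht.1, mul_lt_mul_of_pos_left ht.2 hν⟩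
  have key := hM₁ (ν * t) hs x
  rw [hvdef, timeRescale_apply, ← mul_assoc, inv_mul_cancel₀ hν.ne', one_mul, norm_smul,
    Real.norm_eq_abs, abs_of_pos hν'] at key
  rwa [inv_mul_le_iff₀ hν] at key

/-! ### Consequences for `knss_no_axisymmetric_typeI` (ns.S24, second clause) -/

section Consequences

variable {ν T : ℝ} {u : ℝ → EuclideanSpace ℝ (Fin 3) → EuclideanSpace ℝ (Fin 3)}
  {p : ℝ → EuclideanSpace ℝ (Fin 3) → ℝ}

/-- **Alternative 2 of `knss_no_axisymmetric_typeI` from §4 on a window, Theorem 5.3 and the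
continuation principle.** A classical solution on `ℝ³ × [0, T)` (`ν > 0`, `T > 0`), Leray–Hopf
on `[0, T)`, bounded on `[0, T'] × ℝ³` for every `T' < T`, axisymmetric, with `r ‖u‖ ≤ C` on
`[0, T) × ℝ³`, extends smoothly past `T`: `hasSmoothExtensionPast_of_cylRadius_mul_norm_le`
(KNSS 2009, Thm. 6.1 with Remark 6.2) with Theorem 6.1 supplied by
`KNSS2009_regularity_bound_C_over_r_of_window_of_liouville`. [cite: KochNadirashviliSereginSverak2009, Thm 6.1 and Remark 6.2 (arXiv p. 11)] -/
theorem hasSmoothExtensionPast_of_cylRadius_mul_norm_le_of_window_of_liouville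
    (hW : KNSS2009_regularity_boundedWeak_window) (h53 : KNSS2009_liouville_bound_C_over_r)
    (hB : hasSmoothExtensionPast_of_bounded) (hν : 0 < ν) (hT : 0 < T)
    (h : IsClassicalNSSolutionOn (Ico 0 T) ν 0 u p) (hLH : IsLerayHopfOn T ν 0 (u 0) u)
    (hbdd : ∀ T' < T, ∃ M : ℝ, ∀ t ∈ Icc 0 T', ∀ x, ‖u t x‖ ≤ M)
    (haxi : ∀ t ∈ Ico 0 T, IsAxisymmetric (u t))
    (hC : ∃ C : ℝ, ∀ t ∈ Ico 0 T, ∀ x, cylRadius x * ‖u t x‖ ≤ C) :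
    HasSmoothExtensionPast ν 0 u T :=
  hasSmoothExtensionPast_of_cylRadius_mul_norm_le
    (KNSS2009_regularity_bound_C_over_r_of_window_of_liouville hW h53) hB hν hT h hLH hbdd haxi hC

/-- **`knss_no_axisymmetric_typeI` from its parts, with Theorem 6.1 replaced by §4 on a window
and Theorem 5.3**: the accepted fact `knss_no_axisymmetric_typeI` (`Axisymmetric.lean`) follows
from `KNSS2009_regularity_boundedWeak_window`, `KNSS2009_liouville_bound_C_over_r`, the
continuation of bounded classical Leray–Hopf solutions (`hasSmoothExtensionPast_of_bounded`)
and the boundedness form of the exclusion of axisymmetric Type I blow-up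
(`axisymmetric_typeI_bounded`) — `knss_no_axisymmetric_typeI_of_parts` with Theorem 6.1
supplied by `KNSS2009_regularity_bound_C_over_r_of_window_of_liouville`. [cite: KochNadirashviliSereginSverak2009, Thms 6.1–6.2 (§6, arXiv pp. 11–13)] -/
theorem knss_no_axisymmetric_typeI_of_window_of_liouville
    (hW : KNSS2009_regularity_boundedWeak_window) (h53 : KNSS2009_liouville_bound_C_over_r)
    (hB : hasSmoothExtensionPast_of_bounded) (hP : axisymmetric_typeI_bounded) :
    knss_no_axisymmetric_typeI :=
  knss_no_axisymmetric_typeI_of_parts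
    (KNSS2009_regularity_bound_C_over_r_of_window_of_liouville hW h53) hB hP

end Consequences

end Literature.Analysis.FluidPDE

end
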